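import Mathlib.Analysis.Calculus.ImplicitContDiff
import Mathlib.Analysis.Calculus.Deriv.Polynomial
import Mathlib.Analysis.Calculus.ContDiff.Polynomial
import Mathlib.FieldTheory.AlgebraicClosure
import Summits.KontsevichZagierPeriods.KontsevichZagierPeriods.Theorems.SoloInformedArcRelation

/-!
# Smoothness and algebraic values of a semialgebraic function at its good points (Rung 2, file E2)

Solo programme `solo-KontsevichZagierPeriods-informed`, step L2(b) of `paper/rung2-v2.md`. Let
`p ∈ ℚ[x][y]` be a relation of `f : ℝ → ℝ` on an open set `S` (`p(t, f t) = 0`), `f` continuous on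
`S`. A point `t₀ ∈ S` is GOOD if `∂_y p(t₀, f t₀) ≠ 0`. At a good point `f` is `C^∞` (real implicit
function theorem and its uniqueness clause: `f` coincides near `t₀` with the implicit function,
`soloInformed_contDiffAt_of_good`), and if moreover `t₀` is algebraic then so is `f t₀`
(`soloInformed_isAlgebraic_of_good`). [Bochnak–Coste–Roy 1998, Prop. 8.1.8 ("Nash"); folklore]
-/

noncomputable section

open Polynomial Set Filter Topology
open scoped ContDiff

namespace Summit.KontsevichZagierPeriods.KontsevichZagierPeriods.Theorems

/-! ## 1. Calculus of the real evaluation -/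

/-- The one-variable real polynomial `p(t, ·)`. -/
def soloInformedSliceY (p : ℚ[X][X]) (t : ℝ) : ℝ[X] :=
  (p.map (mapRingHom (algebraMap ℚ ℝ))).map (evalRingHom t)

/-- `p(t, y)` is the evaluation at `y` of the slice `p(t, ·)`. -/
theorem soloInformedEvR_eq_eval_sliceY (p : ℚ[X][X]) (t y : ℝ) :
    soloInformedEvR t y p = (soloInformedSliceY p t).eval y := by
  rw [soloInformedEvR_apply, soloInformedSliceY, eval_map, evalEval, eval₂_evalRingHom]

/-- The slice of `∂_y p` is the derivative of the slice. -/
theorem soloInformedSliceY_derivative (p : ℚ[X][X]) (t : ℝ) :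
    soloInformedSliceY (derivative p) t = derivative (soloInformedSliceY p t) := by
  rw [soloInformedSliceY, soloInformedSliceY, derivative_map, derivative_map]

/-- `y ↦ p(t, y)` has derivative `∂_y p(t, y)`. -/
theorem soloInformed_hasDerivAt_evR_y (p : ℚ[X][X]) (t y : ℝ) :
    HasDerivAt (fun y => soloInformedEvR t y p) (soloInformedEvR t y (derivative p)) y := by
  have h := (soloInformedSliceY p t).hasDerivAt y
  rw [← soloInformedSliceY_derivative, ← soloInformedEvR_eq_eval_sliceY] at h
  refine h.congr_of_eventuallyEq (Eventually.of_forall fun y => ?_)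
  exact soloInformedEvR_eq_eval_sliceY p t y

/-- `(t, y) ↦ p(t, y)` is smooth (indeed polynomial). -/
theorem soloInformed_contDiff_evR (p : ℚ[X][X]) {n : WithTop ℕ∞} :
    ContDiff ℝ n fun z : ℝ × ℝ => soloInformedEvR z.1 z.2 p := by
  induction p using Polynomial.induction_on' with
  | add p q hp hq => simpa only [map_add] using hp.add hq
  | monomial k a =>
    have h : ∀ z : ℝ × ℝ, soloInformedEvR z.1 z.2 (monomial k a) = aeval z.1 a * z.2 ^ k := by
      intro z
      rw [← C_mul_X_pow_eq_monomial, map_mul, map_pow, soloInformedEvR_C, soloInformedEvR_X,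
        eval_map, ← aeval_def]
    simp_rw [h]
    exact ((Polynomial.contDiff_aeval a n).comp contDiff_fst).mul (contDiff_snd.pow k)

/-! ## 2. Smoothness at good points -/

/-- **A continuous root is smooth at a good point.** If `p(t, f t) = 0` on an open set `S`, `f` is
continuous on `S`, `t₀ ∈ S` and `∂_y p(t₀, f t₀) ≠ 0`, then `f` is `C^∞` at `t₀`: by the implicit
function theorem and continuity, `f` agrees near `t₀` with the smooth implicit function.
[Bochnak–Coste–Roy 1998, Prop. 8.1.8; folklore] -/
theorem soloInformed_contDiffAt_of_good {S : Set ℝ} (hS : IsOpen S) {f : ℝ → ℝ}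
    (hf : ContinuousOn f S) {p : ℚ[X][X]} (hp : ∀ t ∈ S, soloInformedEvR t (f t) p = 0) {t₀ : ℝ}
    (ht₀ : t₀ ∈ S) (hgood : soloInformedEvR t₀ (f t₀) (derivative p) ≠ 0) {n : WithTop ℕ∞}
    (hn : n ≠ 0) : ContDiffAt ℝ n f t₀ := by
  set F : ℝ × ℝ → ℝ := fun z => soloInformedEvR z.1 z.2 p with hF
  set u : ℝ × ℝ := (t₀, f t₀) with hu
  have cdf : ContDiffAt ℝ n F u := (soloInformed_contDiff_evR p).contDiffAt
  -- the partial derivative in `y` is invertible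
  set L : ℝ →L[ℝ] ℝ := fderiv ℝ F u ∘L ContinuousLinearMap.inr ℝ ℝ ℝ with hL
  have hL1 : L 1 = soloInformedEvR t₀ (f t₀) (derivative p) := by
    have h1 : HasFDerivAt F (fderiv ℝ F u) u := (cdf.differentiableAt hn).hasFDerivAt
    have h3 : HasDerivAt (fun y : ℝ => ((t₀, y) : ℝ × ℝ)) ((0, 1) : ℝ × ℝ) (f t₀) :=
      (hasDerivAt_const (f t₀) t₀).prodMk (hasDerivAt_id (f t₀))
    have h2 : HasDerivAt (fun y : ℝ => F (t₀, y)) (fderiv ℝ F u (0, 1)) (f t₀) :=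
      h1.comp_hasDerivAt (f t₀) h3
    have h6 : HasDerivAt (fun y : ℝ => F (t₀, y)) (soloInformedEvR t₀ (f t₀) (derivative p)) (f t₀) :=
      soloInformed_hasDerivAt_evR_y p t₀ (f t₀)
    rw [hL, ContinuousLinearMap.comp_apply, ContinuousLinearMap.inr_apply, ← h6.unique h2]
  have if₂ : L.IsInvertible := by
    refine ⟨ContinuousLinearEquiv.unitsEquivAut ℝ (Units.mk0 (L 1) (by rwa [hL1])), ?_⟩
    ext
    rw [ContinuousLinearEquiv.coe_coe, ContinuousLinearEquiv.unitsEquivAut_apply, Units.val_mk0,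
      one_mul]
  -- the implicit function and its uniqueness
  have hψ : ContDiffAt ℝ n (cdf.implicitFunction hn if₂) u.1 := cdf.contDiffAt_implicitFunction hn if₂
  have huniq := cdf.eventually_apply_eq_iff_implicitFunction hn if₂
  have hcont : ContinuousAt f t₀ := hf.continuousAt (hS.mem_nhds ht₀)
  have htend : Tendsto (fun t => ((t, f t) : ℝ × ℝ)) (𝓝 t₀) (𝓝 u) :=
    (continuous_id.tendsto t₀).prodMk_nhds hcont
  have hev : f =ᶠ[𝓝 t₀] cdf.implicitFunction hn if₂ := by
    filter_upwards [htend.eventually huniq, hS.mem_nhds ht₀] with t ht htS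
    have hFt : F (t, f t) = F u := by
      show soloInformedEvR t (f t) p = soloInformedEvR t₀ (f t₀) p
      rw [hp t htS, hp t₀ ht₀]
    exact (ht.1 hFt).symm
  exact hψ.congr_of_eventuallyEq hev

/-- **`C¹` on a neighbourhood of a good compact interval.** If every point of `[u, v] ⊆ S` is good,
`f` is `C^n` on an open set containing `[u, v]`. -/
theorem soloInformed_contDiffOn_nhds_of_good {S : Set ℝ} (hS : IsOpen S) {f : ℝ → ℝ}
    (hf : ContinuousOn f S) {p : ℚ[X][X]} (hp : ∀ t ∈ S, soloInformedEvR t (f t) p = 0) {u v : ℝ}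
    (huv : Icc u v ⊆ S) (hgood : ∀ t ∈ Icc u v, soloInformedEvR t (f t) (derivative p) ≠ 0)
    {n : WithTop ℕ∞} (hn : n ≠ 0) :
    ∃ U : Set ℝ, IsOpen U ∧ Icc u v ⊆ U ∧ U ⊆ S ∧ ContDiffOn ℝ n f U ∧
      ∀ t ∈ U, soloInformedEvR t (f t) (derivative p) ≠ 0 := by
  -- the set of good points of `S` is open
  set U : Set ℝ := {t ∈ S | soloInformedEvR t (f t) (derivative p) ≠ 0} with hU
  have hUo : IsOpen U := by
    rw [isOpen_iff_mem_nhds]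
    rintro t ⟨htS, ht⟩
    have hc : ContinuousAt (fun t => soloInformedEvR t (f t) (derivative p)) t := by
      have h1 : ContinuousAt f t := hf.continuousAt (hS.mem_nhds htS)
      exact ((soloInformed_contDiff_evR (derivative p) (n := 0)).continuous.continuousAt.comp
        (continuousAt_id.prodMk h1) : _)
    filter_upwards [hS.mem_nhds htS, hc.eventually_ne ht] with s hs hs'
    exact ⟨hs, hs'⟩
  refine ⟨U, hUo, fun t ht => ⟨huv ht, hgood t ht⟩, fun t ht => ht.1, ?_, fun t ht => ht.2⟩
  intro t ht
  exact (soloInformed_contDiffAt_of_good hS hf hp ht.1 ht.2 hn).contDiffWithinAt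

/-! ## 3. Algebraic values at algebraic good points -/

/-- At a good point the slice `p(t₀, ·)` is a non-zero polynomial. -/
theorem soloInformedSliceY_ne_zero_of_good {p : ℚ[X][X]} {t₀ y : ℝ}
    (hgood : soloInformedEvR t₀ y (derivative p) ≠ 0) : soloInformedSliceY p t₀ ≠ 0 := by
  intro h
  apply hgood
  rw [soloInformedEvR_eq_eval_sliceY, soloInformedSliceY_derivative, h, derivative_zero, eval_zero]

/-- **Algebraic values.** If `t₀` is algebraic, `p(t₀, y) = 0` and `∂_y p(t₀, y) ≠ 0`, then `y` is
algebraic: it is a root of the non-zero polynomial `p(t₀, ·)`, whose coefficients are algebraic.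
[folklore] -/
theorem soloInformed_isAlgebraic_of_good {p : ℚ[X][X]} {t₀ y : ℝ} (ht₀ : IsAlgebraic ℚ t₀)
    (h0 : soloInformedEvR t₀ y p = 0) (hgood : soloInformedEvR t₀ y (derivative p) ≠ 0) :
    IsAlgebraic ℚ y := by
  let K : IntermediateField ℚ ℝ := algebraicClosure ℚ ℝ
  haveI : Algebra.IsAlgebraic ℚ K := algebraicClosure.isAlgebraic ℚ ℝ
  set t₁ : K := ⟨t₀, mem_algebraicClosure_iff.2 ht₀⟩ with ht₁
  -- the slice over `K`
  set q : K[X] := (p.map (mapRingHom (algebraMap ℚ K))).map (evalRingHom t₁) with hq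
  have hqmap : q.map (algebraMap K ℝ) = soloInformedSliceY p t₀ := by
    refine Polynomial.ext fun k => ?_
    rw [soloInformedSliceY, coeff_map, coeff_map, coeff_map, coeff_map, coeff_map, coe_mapRingHom,
      coe_mapRingHom, coe_evalRingHom, coe_evalRingHom, eval_map, eval_map, hom_eval₂]
    congr 1
  have hq0 : q ≠ 0 := by
    intro h
    apply soloInformedSliceY_ne_zero_of_good hgood
    rw [← hqmap, h, Polynomial.map_zero]
  have hyK : IsAlgebraic K y := by
    refine ⟨q, hq0, ?_⟩
    rw [aeval_def, ← eval_map, hqmap, ← soloInformedEvR_eq_eval_sliceY, h0]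
  have hKint : Algebra.IsIntegral ℚ K := Algebra.isAlgebraic_iff_isIntegral.mp inferInstance
  exact isAlgebraic_iff_isIntegral.2 (isIntegral_trans y (isAlgebraic_iff_isIntegral.1 hyK))

end Summit.KontsevichZagierPeriods.KontsevichZagierPeriods.Theorems
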